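import Mathlib
import Literature.Probability.LatticeModels.ThermodynamicLimit
import Literature.Probability.LatticeModels.SharpnessProofs
import Literature.NumberTheory.Sieve.BombieriAsymptoticSieveMertens
import Literature.Analysis.Complex.BochnerArgRegion
import HarnessLib

/-!
# Helpers (III) for stub `stub_kernelScaling` of line `diffusive-branch-is-nonsaturation`
(crux `PrecisionLaplacian.DirectCorrelationStableTail`, item stmt-CriticalPhenomena-4799)

**Scalar inequalities for the second difference of the Gaussian–cosine test function.**  Writing
`a = 2 − e^{-τ} cos κ (e^{β} + e^{-β})`, `b = e^{-τ} sin κ (e^{β} − e^{-β})` for the two factors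
appearing in the closed form `2φ(w) − φ(w+u) − φ(w−u) = e^{-t|w|₂²}(cos θ · a − sin θ · b)` of the
symmetric second difference of `φ(w) = e^{-t|w|₂²}cos(k·w)` (`θ = k·w`, `β = 2t w·u`, `τ = t|u|₂²`,
`κ = k·u`), the elementary inequalities `|eˣ − 1| ≤ |x|e^{|x|}`, `1 − cos κ ≤ κ²/2`, `|sin κ| ≤ |κ|`,
`1 − e^{-τ} ≤ τ` (the first reused from `BombieriSieve.abs_exp_sub_one_le`, and
`eˣ + e⁻ˣ ≤ 2e^{|x|}` from `Literature.Analysis.Complex.exp_add_exp_neg_le`) give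
`|a| + |b| ≤ 2e^{2|β|}(β² + τ + κ²)` and the variation bound
`|a(β') − a(β)| + |b(β') − b(β)| ≤ e^{|β|+2|β'−β|}|β' − β|(2|β| + |β' − β| + 2|κ|)`
(registered helper sub-goal `stub_kernelScaling_auxABBounds`), together with the variation of
`E(cos θ · a − sin θ · b)` in all its arguments.  All statements are folklore; no definitions.
-/

noncomputable section

namespace Summit.CriticalPhenomena.Ising3DConformalLimit.Cruxes.DirectCorrelationStableTail.DiffusiveBranchIsNonsaturation

open Filter Topology
open scoped BigOperators
open Literature.Probability.LatticeModels

/-! ### Scalar exponential and trigonometric inequalities -/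

/-- `|eᵃ − eᵇ| ≤ |a − b| e^{max(a,b)}`. [folklore] -/
theorem kernSc_abs_exp_sub_exp_le (a b : ℝ) :
    |Real.exp a - Real.exp b| ≤ |a - b| * Real.exp (max a b) := by
  -- reduce to `eᵖ − e^q ≤ (p − q) eᵖ` for `q ≤ p`
  have key : ∀ p q : ℝ, q ≤ p → Real.exp p - Real.exp q ≤ (p - q) * Real.exp p := by
    intro p q hqp
    have h1 : -(p - q) + 1 ≤ Real.exp (-(p - q)) := Real.add_one_le_exp _
    have h2 : Real.exp (-(p - q)) * Real.exp p = Real.exp q := by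
      rw [← Real.exp_add]
      congr 1
      ring
    nlinarith [Real.exp_pos p, mul_le_mul_of_nonneg_right h1 (Real.exp_pos p).le]
  rcases le_total b a with h | h
  · rw [max_eq_left h, abs_of_nonneg (by linarith [Real.exp_le_exp.2 h]), abs_of_nonneg (by linarith)]
    exact key a b h
  · rw [max_eq_right h, abs_sub_comm, abs_of_nonneg (by linarith [Real.exp_le_exp.2 h]),
      abs_sub_comm, abs_of_nonneg (by linarith)]
    exact key b a h

/-- `|eˣ + e⁻ˣ − 2| ≤ x² e^{2|x|}` (from `eˣ + e⁻ˣ − 2 = (eˣ − 1)(1 − e⁻ˣ)`). [folklore] -/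
theorem kernSc_cosh_sub_two_le (x : ℝ) :
    |Real.exp x + Real.exp (-x) - 2| ≤ x ^ 2 * Real.exp (2 * |x|) := by
  have h1 : Real.exp x * Real.exp (-x) = 1 := by rw [← Real.exp_add, add_neg_cancel, Real.exp_zero]
  have h2 : Real.exp x + Real.exp (-x) - 2 = (Real.exp x - 1) * (1 - Real.exp (-x)) := by
    linear_combination h1
  rw [h2, abs_mul, abs_sub_comm 1]
  have ha := Literature.NumberTheory.Sieve.BombieriSieve.abs_exp_sub_one_le x
  have hb := Literature.NumberTheory.Sieve.BombieriSieve.abs_exp_sub_one_le (-x)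
  rw [abs_neg] at hb
  calc |Real.exp x - 1| * |Real.exp (-x) - 1| ≤ (|x| * Real.exp |x|) * (|x| * Real.exp |x|) :=
        mul_le_mul ha hb (abs_nonneg _) (by positivity)
    _ = x ^ 2 * Real.exp (2 * |x|) := by
        rw [two_mul, Real.exp_add, ← sq_abs x]
        ring

/-- `|eˣ − e⁻ˣ| ≤ 2|x| e^{|x|}`. [folklore] -/
theorem kernSc_sinh_le (x : ℝ) : |Real.exp x - Real.exp (-x)| ≤ 2 * |x| * Real.exp |x| := by
  have h : Real.exp x - Real.exp (-x) = (Real.exp x - 1) - (Real.exp (-x) - 1) := by ring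
  rw [h]
  have ha := Literature.NumberTheory.Sieve.BombieriSieve.abs_exp_sub_one_le x
  have hb := Literature.NumberTheory.Sieve.BombieriSieve.abs_exp_sub_one_le (-x)
  rw [abs_neg] at hb
  calc |Real.exp x - 1 - (Real.exp (-x) - 1)| ≤ |Real.exp x - 1| + |Real.exp (-x) - 1| :=
        abs_sub _ _
    _ ≤ |x| * Real.exp |x| + |x| * Real.exp |x| := add_le_add ha hb
    _ = 2 * |x| * Real.exp |x| := by ring

/-- `|1 − e^{-τ}| ≤ τ` for `τ ≥ 0`. [folklore] -/
theorem kernSc_one_sub_exp_neg_le {τ : ℝ} (hτ : 0 ≤ τ) : |1 - Real.exp (-τ)| ≤ τ := by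
  have h1 : Real.exp (-τ) ≤ 1 := Real.exp_le_one_iff.2 (by linarith)
  have h2 : -τ + 1 ≤ Real.exp (-τ) := Real.add_one_le_exp _
  rw [abs_of_nonneg (by linarith)]
  linarith

/-- `|1 − cos κ| ≤ κ²/2`. [folklore] -/
theorem kernSc_abs_one_sub_cos_le (κ : ℝ) : |1 - Real.cos κ| ≤ κ ^ 2 / 2 := by
  rw [abs_of_nonneg (by linarith [Real.cos_le_one κ])]
  linarith [Real.one_sub_sq_div_two_le_cos (x := κ)]

/-! ### The scalar second-difference factors `a`, `b` -/

/-- Size of the factors: `|a| + |b| ≤ 2 e^{2|β|} (β² + τ + κ²)` where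
`a = 2 − e^{-τ} cos κ (e^{β} + e^{-β})`, `b = e^{-τ} sin κ (e^{β} − e^{-β})`, `τ ≥ 0`. [folklore] -/
theorem kernSc_ab_bound {τ κ β : ℝ} (hτ : 0 ≤ τ) :
    |2 - Real.exp (-τ) * Real.cos κ * (Real.exp β + Real.exp (-β))| +
        |Real.exp (-τ) * Real.sin κ * (Real.exp β - Real.exp (-β))| ≤
      2 * Real.exp (2 * |β|) * (β ^ 2 + τ + κ ^ 2) := by
  set P : ℝ := Real.exp |β| with hP
  have hP1 : 1 ≤ P := Real.one_le_exp (abs_nonneg β)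
  have hP2 : Real.exp (2 * |β|) = P ^ 2 := by rw [hP, sq, ← Real.exp_add, two_mul]
  set C : ℝ := Real.exp β + Real.exp (-β) with hC
  set D : ℝ := Real.exp β - Real.exp (-β) with hD
  have hC0 : 0 ≤ C := by positivity
  have hCle : C ≤ 2 * P ^ 2 := (Literature.Analysis.Complex.exp_add_exp_neg_le β).trans (by nlinarith)
  have h2C : |2 - C| ≤ β ^ 2 * P ^ 2 := by
    rw [abs_sub_comm, ← hP2]
    simpa [hC] using kernSc_cosh_sub_two_le β
  have hDle : |D| ≤ 2 * |β| * P := kernSc_sinh_le β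
  have he1 : Real.exp (-τ) ≤ 1 := Real.exp_le_one_iff.2 (by linarith)
  have he0 : 0 ≤ Real.exp (-τ) := (Real.exp_pos _).le
  have hm : |1 - Real.exp (-τ) * Real.cos κ| ≤ τ + κ ^ 2 / 2 := by
    have h : 1 - Real.exp (-τ) * Real.cos κ =
        (1 - Real.exp (-τ)) + Real.exp (-τ) * (1 - Real.cos κ) := by ring
    rw [h]
    refine (abs_add_le _ _).trans (add_le_add (kernSc_one_sub_exp_neg_le hτ) ?_)
    rw [abs_mul, abs_of_nonneg he0]
    calc Real.exp (-τ) * |1 - Real.cos κ| ≤ 1 * (κ ^ 2 / 2) :=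
          mul_le_mul he1 (kernSc_abs_one_sub_cos_le κ) (abs_nonneg _) zero_le_one
      _ = κ ^ 2 / 2 := one_mul _
  have ha : |2 - Real.exp (-τ) * Real.cos κ * C| ≤ P ^ 2 * (β ^ 2 + 2 * τ + κ ^ 2) := by
    have h : 2 - Real.exp (-τ) * Real.cos κ * C = (2 - C) + (1 - Real.exp (-τ) * Real.cos κ) * C := by
      ring
    rw [h]
    refine (abs_add_le _ _).trans ?_
    rw [abs_mul, abs_of_nonneg hC0]
    calc |2 - C| + |1 - Real.exp (-τ) * Real.cos κ| * C
        ≤ β ^ 2 * P ^ 2 + (τ + κ ^ 2 / 2) * (2 * P ^ 2) :=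
          add_le_add h2C (mul_le_mul hm hCle hC0 (by positivity))
      _ = P ^ 2 * (β ^ 2 + 2 * τ + κ ^ 2) := by ring
  have hb : |Real.exp (-τ) * Real.sin κ * D| ≤ P ^ 2 * (κ ^ 2 + β ^ 2) := by
    rw [abs_mul, abs_mul, abs_of_nonneg he0]
    have h2 : 2 * |κ| * |β| ≤ κ ^ 2 + β ^ 2 := by
      nlinarith [sq_nonneg (|κ| - |β|), sq_abs κ, sq_abs β]
    calc Real.exp (-τ) * |Real.sin κ| * |D| ≤ 1 * |κ| * (2 * |β| * P) :=
          mul_le_mul (mul_le_mul he1 Real.abs_sin_le_abs (abs_nonneg _) zero_le_one) hDle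
            (abs_nonneg _) (by positivity)
      _ = (2 * |κ| * |β|) * P := by ring
      _ ≤ (κ ^ 2 + β ^ 2) * P := mul_le_mul_of_nonneg_right h2 (by positivity)
      _ ≤ (κ ^ 2 + β ^ 2) * P ^ 2 := by
          apply mul_le_mul_of_nonneg_left _ (by positivity)
          nlinarith
      _ = P ^ 2 * (κ ^ 2 + β ^ 2) := by ring
  rw [hP2]
  calc |2 - Real.exp (-τ) * Real.cos κ * C| + |Real.exp (-τ) * Real.sin κ * D|
      ≤ P ^ 2 * (β ^ 2 + 2 * τ + κ ^ 2) + P ^ 2 * (κ ^ 2 + β ^ 2) := add_le_add ha hb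
    _ = 2 * P ^ 2 * (β ^ 2 + τ + κ ^ 2) := by ring

/-- Variation of the factors in `β`: with `η = β' − β`,
`|a(β') − a(β)| + |b(β') − b(β)| ≤ e^{|β| + 2|η|} |η| (2|β| + |η| + 2|κ|)`. [folklore] -/
theorem kernSc_ab_diff_bound (τ κ β β' : ℝ) (hτ : 0 ≤ τ) :
    |(2 - Real.exp (-τ) * Real.cos κ * (Real.exp β' + Real.exp (-β'))) -
          (2 - Real.exp (-τ) * Real.cos κ * (Real.exp β + Real.exp (-β)))| +
        |Real.exp (-τ) * Real.sin κ * (Real.exp β' - Real.exp (-β')) -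
          Real.exp (-τ) * Real.sin κ * (Real.exp β - Real.exp (-β))| ≤
      Real.exp (|β| + 2 * |β' - β|) * |β' - β| * (2 * |β| + |β' - β| + 2 * |κ|) := by
  set η : ℝ := β' - β with hη
  set P : ℝ := Real.exp |β| with hP
  set Q : ℝ := Real.exp (2 * |η|) with hQ
  have hPQ : Real.exp (|β| + 2 * |η|) = P * Q := by rw [Real.exp_add]
  have hQ1 : 1 ≤ Q := Real.one_le_exp (by positivity)
  have heQ : Real.exp |η| ≤ Q := Real.exp_le_exp.2 (by linarith [abs_nonneg η])
  have heβ : Real.exp β ≤ P := Real.exp_le_exp.2 (le_abs_self β)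
  have heβ' : Real.exp (-β) ≤ P := Real.exp_le_exp.2 (by linarith [neg_abs_le β])
  have hβ' : β' = β + η := by rw [hη]; ring
  have hexp1 : Real.exp β' = Real.exp β * Real.exp η := by rw [hβ', Real.exp_add]
  have hexp2 : Real.exp (-β') = Real.exp (-β) * Real.exp (-η) := by
    rw [hβ', neg_add, Real.exp_add]
  have hη1 := Literature.NumberTheory.Sieve.BombieriSieve.abs_exp_sub_one_le η
  have hη2 := Literature.NumberTheory.Sieve.BombieriSieve.abs_exp_sub_one_le (-η)
  rw [abs_neg] at hη2
  -- the even combination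
  have hDp : |(Real.exp β' + Real.exp (-β')) - (Real.exp β + Real.exp (-β))| ≤
      P * Q * |η| * (2 * |β| + |η|) := by
    have h : (Real.exp β' + Real.exp (-β')) - (Real.exp β + Real.exp (-β)) =
        (Real.exp β - Real.exp (-β)) * (Real.exp η - 1) +
          Real.exp (-β) * (Real.exp η + Real.exp (-η) - 2) := by
      rw [hexp1, hexp2]
      ring
    rw [h]
    refine (abs_add_le _ _).trans ?_
    rw [abs_mul, abs_mul, abs_of_nonneg (Real.exp_pos (-β)).le]
    calc |Real.exp β - Real.exp (-β)| * |Real.exp η - 1| +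
          Real.exp (-β) * |Real.exp η + Real.exp (-η) - 2|
        ≤ (2 * |β| * P) * (|η| * Q) + P * (η ^ 2 * Q) := by
          refine add_le_add (mul_le_mul (kernSc_sinh_le β) (hη1.trans ?_) (abs_nonneg _)
            (by positivity)) (mul_le_mul heβ' ((kernSc_cosh_sub_two_le η).trans le_rfl)
            (abs_nonneg _) (by positivity))
          exact mul_le_mul_of_nonneg_left heQ (abs_nonneg _)
      _ = P * Q * |η| * (2 * |β| + |η|) := by rw [← sq_abs η]; ring
  -- the odd combination
  have hDm : |(Real.exp β' - Real.exp (-β')) - (Real.exp β - Real.exp (-β))| ≤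
      2 * P * Q * |η| := by
    have h : (Real.exp β' - Real.exp (-β')) - (Real.exp β - Real.exp (-β)) =
        Real.exp β * (Real.exp η - 1) - Real.exp (-β) * (Real.exp (-η) - 1) := by
      rw [hexp1, hexp2]
      ring
    rw [h]
    refine (abs_sub _ _).trans ?_
    rw [abs_mul, abs_mul, abs_of_nonneg (Real.exp_pos β).le, abs_of_nonneg (Real.exp_pos (-β)).le]
    calc Real.exp β * |Real.exp η - 1| + Real.exp (-β) * |Real.exp (-η) - 1|
        ≤ P * (|η| * Q) + P * (|η| * Q) :=
          add_le_add (mul_le_mul heβ (hη1.trans (mul_le_mul_of_nonneg_left heQ (abs_nonneg _)))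
            (abs_nonneg _) (by positivity))
            (mul_le_mul heβ' (hη2.trans (mul_le_mul_of_nonneg_left heQ (abs_nonneg _)))
            (abs_nonneg _) (by positivity))
      _ = 2 * P * Q * |η| := by ring
  have he1 : Real.exp (-τ) ≤ 1 := Real.exp_le_one_iff.2 (by linarith)
  have he0 : 0 ≤ Real.exp (-τ) := (Real.exp_pos _).le
  have hA : |(2 - Real.exp (-τ) * Real.cos κ * (Real.exp β' + Real.exp (-β'))) -
      (2 - Real.exp (-τ) * Real.cos κ * (Real.exp β + Real.exp (-β)))| ≤
      P * Q * |η| * (2 * |β| + |η|) := by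
    have h : (2 - Real.exp (-τ) * Real.cos κ * (Real.exp β' + Real.exp (-β'))) -
        (2 - Real.exp (-τ) * Real.cos κ * (Real.exp β + Real.exp (-β))) =
        -(Real.exp (-τ) * Real.cos κ) *
          ((Real.exp β' + Real.exp (-β')) - (Real.exp β + Real.exp (-β))) := by ring
    rw [h, abs_mul, abs_neg, abs_mul, abs_of_nonneg he0]
    calc Real.exp (-τ) * |Real.cos κ| * |(Real.exp β' + Real.exp (-β')) - (Real.exp β + Real.exp (-β))|
        ≤ 1 * 1 * (P * Q * |η| * (2 * |β| + |η|)) :=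
          mul_le_mul (mul_le_mul he1 (Real.abs_cos_le_one κ) (abs_nonneg _) zero_le_one) hDp
            (abs_nonneg _) (by positivity)
      _ = P * Q * |η| * (2 * |β| + |η|) := by ring
  have hB : |Real.exp (-τ) * Real.sin κ * (Real.exp β' - Real.exp (-β')) -
      Real.exp (-τ) * Real.sin κ * (Real.exp β - Real.exp (-β))| ≤ |κ| * (2 * P * Q * |η|) := by
    rw [← mul_sub, abs_mul, abs_mul, abs_of_nonneg he0]
    calc Real.exp (-τ) * |Real.sin κ| * |(Real.exp β' - Real.exp (-β')) - (Real.exp β - Real.exp (-β))|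
        ≤ 1 * |κ| * (2 * P * Q * |η|) :=
          mul_le_mul (mul_le_mul he1 Real.abs_sin_le_abs (abs_nonneg _) zero_le_one) hDm
            (abs_nonneg _) (by positivity)
      _ = |κ| * (2 * P * Q * |η|) := by ring
  rw [hPQ]
  calc _ ≤ P * Q * |η| * (2 * |β| + |η|) + |κ| * (2 * P * Q * |η|) := add_le_add hA hB
    _ = P * Q * |η| * (2 * |β| + |η| + 2 * |κ|) := by ring

/-- Variation of `Q(E, θ, a, b) = E (cos θ · a − sin θ · b)` in all its arguments (`E ≥ 0`).
[folklore] -/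
theorem kernSc_Q_diff_bound (E E' θ θ' a a' b b' : ℝ) (hE : 0 ≤ E) :
    |E' * (Real.cos θ' * a' - Real.sin θ' * b') - E * (Real.cos θ * a - Real.sin θ * b)| ≤
      |E' - E| * (|a'| + |b'|) + E * (|θ' - θ| * (|a'| + |b'|) + |a' - a| + |b' - b|) := by
  have h : E' * (Real.cos θ' * a' - Real.sin θ' * b') - E * (Real.cos θ * a - Real.sin θ * b) =
      (E' - E) * (Real.cos θ' * a' - Real.sin θ' * b') +
        E * ((Real.cos θ' - Real.cos θ) * a' - (Real.sin θ' - Real.sin θ) * b' +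
          (Real.cos θ * (a' - a) - Real.sin θ * (b' - b))) := by ring
  rw [h]
  have h1 : |Real.cos θ' * a' - Real.sin θ' * b'| ≤ |a'| + |b'| := by
    refine (abs_sub _ _).trans (add_le_add ?_ ?_)
    · rw [abs_mul]
      exact (mul_le_mul_of_nonneg_right (Real.abs_cos_le_one _) (abs_nonneg _)).trans (by simp)
    · rw [abs_mul]
      exact (mul_le_mul_of_nonneg_right (Real.abs_sin_le_one _) (abs_nonneg _)).trans (by simp)
  have h2 : |(Real.cos θ' - Real.cos θ) * a' - (Real.sin θ' - Real.sin θ) * b'| ≤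
      |θ' - θ| * (|a'| + |b'|) := by
    refine (abs_sub _ _).trans ?_
    rw [abs_mul, abs_mul, mul_add]
    exact add_le_add (mul_le_mul_of_nonneg_right (Real.abs_cos_sub_cos_le _ _) (abs_nonneg _))
      (mul_le_mul_of_nonneg_right (Real.abs_sin_sub_sin_le _ _) (abs_nonneg _))
  have h3 : |Real.cos θ * (a' - a) - Real.sin θ * (b' - b)| ≤ |a' - a| + |b' - b| := by
    refine (abs_sub _ _).trans (add_le_add ?_ ?_)
    · rw [abs_mul]
      exact (mul_le_mul_of_nonneg_right (Real.abs_cos_le_one _) (abs_nonneg _)).trans (by simp)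
    · rw [abs_mul]
      exact (mul_le_mul_of_nonneg_right (Real.abs_sin_le_one _) (abs_nonneg _)).trans (by simp)
  calc _ ≤ |(E' - E) * (Real.cos θ' * a' - Real.sin θ' * b')| +
        |E * ((Real.cos θ' - Real.cos θ) * a' - (Real.sin θ' - Real.sin θ) * b' +
          (Real.cos θ * (a' - a) - Real.sin θ * (b' - b)))| := abs_add_le _ _
    _ ≤ |E' - E| * (|a'| + |b'|) + E * (|θ' - θ| * (|a'| + |b'|) + (|a' - a| + |b' - b|)) := by
        rw [abs_mul, abs_mul, abs_of_nonneg hE]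
        refine add_le_add (mul_le_mul_of_nonneg_left h1 (abs_nonneg _))
          (mul_le_mul_of_nonneg_left ((abs_add_le _ _).trans (add_le_add h2 h3)) hE)
    _ = _ := by ring

/-- **Registered helper sub-goal `stub_kernelScaling_auxABBounds`** of stub `stub_kernelScaling`
(line `diffusive-branch-is-nonsaturation`, crux stmt-CriticalPhenomena-4799): size and variation of the
scalar second-difference factors `a = 2 − e^{-τ}cos κ (e^{β} + e^{-β})`, `b = e^{-τ}sin κ (e^{β} − e^{-β})`.
[folklore] -/
theorem stub_kernelScaling_auxABBounds :
    ∀ (τ κ β β' : ℝ), 0 ≤ τ →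
      (|2 - Real.exp (-τ) * Real.cos κ * (Real.exp β + Real.exp (-β))| +
          |Real.exp (-τ) * Real.sin κ * (Real.exp β - Real.exp (-β))| ≤
        2 * Real.exp (2 * |β|) * (β ^ 2 + τ + κ ^ 2)) ∧
      (|(2 - Real.exp (-τ) * Real.cos κ * (Real.exp β' + Real.exp (-β'))) -
            (2 - Real.exp (-τ) * Real.cos κ * (Real.exp β + Real.exp (-β)))| +
          |Real.exp (-τ) * Real.sin κ * (Real.exp β' - Real.exp (-β')) -
            Real.exp (-τ) * Real.sin κ * (Real.exp β - Real.exp (-β))| ≤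
        Real.exp (|β| + 2 * |β' - β|) * |β' - β| * (2 * |β| + |β' - β| + 2 * |κ|)) :=
  fun τ κ β β' hτ => ⟨kernSc_ab_bound hτ, kernSc_ab_diff_bound τ κ β β' hτ⟩

end Summit.CriticalPhenomena.Ising3DConformalLimit.Cruxes.DirectCorrelationStableTail.DiffusiveBranchIsNonsaturation

end
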